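/-
Origin: expansion seat `planner-pub-hodgecm-mc-axioms-1-g14-0`, handover #W194 2026-08-20T15:53:55Z md5 afa0d9968931 (PKG 2c58d4b339eb → afa0d9968931; 335 l.; MECHANICAL (iib-R) rewrite v3.1 of the PKG file as it stands (112 token edits; rules R1x2+RX[h₂]x110)) (`HOME/mc/pub-hodgecm-mc-axioms-1-g14/revendor/kit-r55/stage55/HodgeCM/Model/Binders/Real34PinsTotalKCensus.lean`, md5 afa0d9968931, 335 lines);
landed by the gen-22 packager (p-g22) in gate run 55 REPLACES the earlier landed copy of `HodgeCM/Model/Binders/Real34PinsTotalKCensus.lean` (seat copy carried the packager Origin header of an earlier run (stripped)).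
-/
/-
Origin: speedrun cell pub-hodgecm, MODEL-CONSTRUCTION sub-cell, unit pub-hodgecm-mc-binder-1-g10 (BINDER PROVER, gen 10; node B2-meet,
BINDER-OWNERS row 15 `real34`), seat prover-pub-hodgecm-mc-binder-1-g10-0, 2026-08-20.
Target in PKG: HodgeCM/Model/Binders/Real34PinsTotalKCensus.lean (NEW additive leaf, RUN 39+; imports #28 `Binders/Real34PinsTotalK` and
mc-binder-2 #22 `HypCensus/SideW` (RUN 37)).
KERNEL ONLY: 0 records of published theorems, nothing cited, 0 `def … : Prop`, MODEL-N ±0, E unchanged.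
Nothing here is a claim of the manuscripts under adjudication.
-/
import Summits.HodgeConjecture.HodgeCM.Model.Binders.Real34PinsTotalK_2
import Summits.HodgeConjecture.HodgeCM.Model.HypCensus.SideW

/-!
# (K34) from the (34) CENSUS SIDE: row 15's K-type datum is row 19's object plus a wedge decomposition of its generators

mc-binder-2's census record `HypSideW (W V c) c.D.jT₃₄ kind lam hlam m₁ m₂` (`HypCensus/SideW`, the object behind E's binder `hyp34`
via `hyp34_of_sideW`) carries an insertion family `ins : FinIdx → 𝓕_print →ₗ 𝒮(𝔸^6)` with `ins_mem` (values in `𝒮^κ`) and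
`dense` (their span is dense in `𝒮^κ` for the theta-initial topology — `HypCensus.dense_insM`).  Since the (34) generator
`ϑ₃₄(χ, ·)` is LINEAR on `𝒮^κ` (§ 1: `t34_ϑ_add`, `t34_ϑ_smul`, from binder-1-g6's `t34_ϑc_mk_eq_smul_torusPeriodW₃₄` and the linearity of
`torusPeriodW₃₄`), mc-discharge-1's density reduction `Real34Loc.gen_mem_of_dense` applies with `P := span (range ins)`, and (K34) at the pinned
record follows from ONE hypothesis on the GENERATORS:

  `hwedge : ∀ f φ, A.ins f φ = Σ_i a_i • (τ φ₂ⁱ⁰ φ₃ⁱ¹ − τ φ₂ⁱ¹ φ₃ⁱ⁰)` over frames of `adm₃₄`-admissible situations of lines 2, 3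

(pure algebra on the printed inserted vectors — at ι₁ `det(z)` IS such a wedge, tree `SegalBargmann/FockRowDeterminantIsotypic` — plus the
hol-type supply for lines 2/3).  § 2 `Real34Loc.gen_mem_ofThetaSat_of_sideW` (generic pins), § 3 `Gen12Pins.gen_mem_totalKS`,
**`real34_totalKS`** / **`real34_totalKSE`**: E's `real34` VERBATIM at the total pins from E's own `hpc hcup hph h31 hLiu`, `hAw`, `hcorr` and,
per good sextic context, a (34) census side `A` with `hwedge`.  So the row-15 datum is NOT a new object: it is the row-19 census side.
-/

set_option autoImplicit false

noncomputable section

open MeasureTheory NumberField MulAction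
open scoped Matrix InnerProductSpace

namespace HodgeCM.Model

open HodgeCM HodgeCM.Universe HodgeCM.Adelic HodgeCM.Model.HypCensus
open HodgeCM.PerL34 HodgeCM.PerL34.Fock HodgeCM.PerL34.Fock.PrintDict
open Literature.NumberTheory.Weil1964
open Literature.NumberTheory.Automorphic (piSchwartzBruhat)
open Literature.NumberTheory.Automorphic.UnitaryGroup (archIsotropy archIsotropyProj archKappa archSectionU21CM)
open Literature.NumberTheory.GelbartRogawski1991.UnitaryDualPair
open Literature.RepresentationTheory.HeisenbergGroup
open Literature.Geometry.ComplexHyperbolic.BallModel (U21 x₀ Jac)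
open Literature.AlgebraicGeometry.HodgeTheory
open Literature.NumberTheory.Automorphic.PicardCM
open Literature.NumberTheory.Transcendental (Arapura2012_Cor_15_4_6)
open HodgeCM.CMTypeOps (inflate)
open HodgeCM.Model.ThetaSpace
open HodgeCM.Model.ArchSideTerm
open NumberField.SeesawTorus (charFst charSnd mem_allowedChars)

/-! ## 1. Linearity of the (34) generator on `𝒮^κ` (generic pins) -/

section Generic

variable (hHD : exists_isReal_hodgeModel) (hI : hodgePQ_independent_of_hodgeModel)
  (h₁ : BallQuotientUniformised)  (h₃ : CMAbelianVarietyRealised)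
variable (h : Bool) (hA : Arapura2012_Cor_15_4_6)
  (W : ∀ {L : CMField} {ι₁ : L →+* ℂ} (V : HermSpace3 L ι₁) (c : SeesawCtx L), WmInput V c.D)
  (S : ∀ {L : CMField} {ι₁ : L →+* ℂ} (V : HermSpace3 L ι₁) (c : SeesawCtx L), ThetaAdelicSide V c)
  (μ : ∀ {L : CMField}, SeesawCtx L → Fin 4 → InfinitePlace L → ℤ)

variable {L : CMField} {ι₁ : L →+* ℂ} (V : HermSpace3 L ι₁) (c : SeesawCtx L) (hV : IsAnisotropic L V.Hm)

local notation3 "L⁺" => maximalRealSubfield (L : Type)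
local notation3 "𝕏" => pinX hHD hI h₁ h₃ S V c hV

/-- the (34) generator is ADDITIVE on `𝒮^κ` (regime of `U(W)`; the test functions are typed at the model's `↥(wmOf' …).SK`, which IS
`(pinT …).SK V c` by `rfl` — binder-2 `cpinT_SK` — and carries the additive structure syntactically). -/
theorem t34_ϑ_add (hW : IsAnisotropic L c.D.gramW) (χ : ((pinT hHD hI h₁ h₃ h hA W S μ).t34 V c).X)
    (Φ Ψ : ↥((wmOf' printFact_unitaryCompact_holds (W V c)).SK)) :
    ((pinT hHD hI h₁ h₃ h hA W S μ).t34 V c).ϑ χ (Φ + Ψ) =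
      ((pinT hHD hI h₁ h₃ h hA W S μ).t34 V c).ϑ χ Φ + ((pinT hHD hI h₁ h₃ h hA W S μ).t34 V c).ϑ χ Ψ := by
  have hcm : (pinR34 hHD hI h₁ h₃ h hA W S μ V c).kt.ϑc χ (Φ + Ψ) =
      (pinR34 hHD hI h₁ h₃ h hA W S μ V c).kt.ϑc χ Φ + (pinR34 hHD hI h₁ h₃ h hA W S μ V c).kt.ϑc χ Ψ := by
    ext q
    induction q using QuotientGroup.induction_on with
    | H x =>
      -- `(Φ + Ψ).1 = Φ.1 + Ψ.1` definitionally; the torus period is additive (binder-1-g6 `torusPeriodW₃₄_add`)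
      have e₁ : ∀ y : ↥(Adelic.adelicUnitaryGroup L V.Hm), torusPeriodW₃₄ (W V c) χ.1 (Φ + Ψ).1 y =
          torusPeriodW₃₄ (W V c) χ.1 Φ.1 y + torusPeriodW₃₄ (W V c) χ.1 Ψ.1 y :=
        fun y => torusPeriodW₃₄_add (W V c) χ.1 Φ.1 Ψ.1 y
      rw [ContinuousMap.add_apply, t34_ϑc_mk_eq_smul_torusPeriodW₃₄ hHD hI h₁ h₃ h hA W S μ V c hW χ (Φ + Ψ) x,
        t34_ϑc_mk_eq_smul_torusPeriodW₃₄ hHD hI h₁ h₃ h hA W S μ V c hW χ Φ x,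
        t34_ϑc_mk_eq_smul_torusPeriodW₃₄ hHD hI h₁ h₃ h hA W S μ V c hW χ Ψ x, e₁, smul_add]
  rw [t34_ϑ_eq_toLp, t34_ϑ_eq_toLp, t34_ϑ_eq_toLp, hcm]
  exact map_add _ _ _

/-- the (34) generator is HOMOGENEOUS on `𝒮^κ` (regime of `U(W)`). -/
theorem t34_ϑ_smul (hW : IsAnisotropic L c.D.gramW) (χ : ((pinT hHD hI h₁ h₃ h hA W S μ).t34 V c).X) (a : ℂ)
    (Φ : ↥((wmOf' printFact_unitaryCompact_holds (W V c)).SK)) :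
    ((pinT hHD hI h₁ h₃ h hA W S μ).t34 V c).ϑ χ (a • Φ) = a • ((pinT hHD hI h₁ h₃ h hA W S μ).t34 V c).ϑ χ Φ := by
  have hcm : (pinR34 hHD hI h₁ h₃ h hA W S μ V c).kt.ϑc χ (a • Φ) = a • (pinR34 hHD hI h₁ h₃ h hA W S μ V c).kt.ϑc χ Φ := by
    ext q
    induction q using QuotientGroup.induction_on with
    | H x =>
      have e₂ : ∀ y : ↥(Adelic.adelicUnitaryGroup L V.Hm), torusPeriodW₃₄ (W V c) χ.1 (a • Φ).1 y =
          a * torusPeriodW₃₄ (W V c) χ.1 Φ.1 y :=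
        fun y => torusPeriodW₃₄_smul (W V c) χ.1 a Φ.1 y
      rw [ContinuousMap.smul_apply, t34_ϑc_mk_eq_smul_torusPeriodW₃₄ hHD hI h₁ h₃ h hA W S μ V c hW χ (a • Φ) x,
        t34_ϑc_mk_eq_smul_torusPeriodW₃₄ hHD hI h₁ h₃ h hA W S μ V c hW χ Φ x, e₂, smul_eq_mul,
        Complex.real_smul, Complex.real_smul]
      ring
  rw [t34_ϑ_eq_toLp, t34_ϑ_eq_toLp, hcm]
  exact map_smul _ _ _

/-- the (34) generator vanishes at `0`. -/
theorem t34_ϑ_zero (hW : IsAnisotropic L c.D.gramW) (χ : ((pinT hHD hI h₁ h₃ h hA W S μ).t34 V c).X) :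
    ((pinT hHD hI h₁ h₃ h hA W S μ).t34 V c).ϑ χ (0 : ↥((wmOf' printFact_unitaryCompact_holds (W V c)).SK)) = 0 := by
  have h0 := t34_ϑ_smul hHD hI h₁ h₃ h hA W S μ V c hW χ 0 (0 : ↥((wmOf' printFact_unitaryCompact_holds (W V c)).SK))
  rwa [zero_smul, zero_smul] at h0

/-! ## 2. (K34) at the pinned record from a (34) census side (generic pins) -/

/-- **(K34) at `Real34Loc.ofThetaSat` from a (34) CENSUS SIDE and a wedge decomposition of its generators.**  `A` is mc-binder-2's
`HypSideW (W V c) c.D.jT₃₄ kind lam hlam m₁ m₂` (any printed kinds/scalings/exponents); its `ins`/`ins_mem`/`dense` give the dense subspace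
`span (range ins) ⊆ 𝒮^κ` (theta-initial topology, `HypCensus.dense_insM`); `hwedge` says every inserted printed vector is a finite sum of wedge
tensors of frame vectors of `adm₃₄`-admissible situations of lines `2`, `3`; linearity of `ϑ₃₄(χ, ·)` (§ 1) extends the per-generator
computation (binder-1 #8 see-saw ∘ D-6 pointwise chain ∘ matched `hRep`, as in #28) to the span, and D-6's `Real34Loc.gen_mem_of_dense` closes. -/
theorem Real34Loc.gen_mem_ofThetaSat_of_sideW
    (hGfin : ∀ kf : V.adelicFin, finTranslate V hV kf ∈ (S V c).Gfin)
    (hcorr : ∀ (Γ : Level V), ∀ δ ∈ levelImage hHD hI h₁ h₃ Γ hV,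
      ∃ x : (V.latticeModel printFact_unitaryCompact_holds).G, x ∈ satLevelRegimeOf V hV Γ.K ∧
        (S V c).ιinf δ * x ∈ (V.latticeModel printFact_unitaryCompact_holds).Γ ∧ ∀ y : U21, Commute x ((S V c).ιinf y))
    (hW : IsAnisotropic L c.D.gramW) (H : SeesawHyp34 W S V c)
    (h2 : ((S V c).P 2).w = ⇑(archWeight L (μ c 2))) (h3 : ((S V c).P 3).w = ⇑(archWeight L (μ c 3)))
    [DecidableEq (InfinitePlace (L : Type))] (kind : InfinitePlace (L : Type) → PlaceKind)
    (lam : InfinitePlace (L : Type) → ℂ) (hlam : ∀ w, lam w ≠ 0) (m₁ m₂ : InfinitePlace (L : Type) → ℤ)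
    (A : HypSideW (W V c) c.D.jT₃₄ kind lam hlam m₁ m₂)
    (hwedge : ∀ (f : A.FinIdx) (φ : (printPlaces (InfinitePlace (L : Type)) kind lam hlam (pinnedVacs kind m₁ m₂)).F),
      ∃ (n : ℕ) (Γ' : Fin n → Level V)
        (Sit₂ : ∀ i, KTypeSituation ((𝕏).P 2) ((𝕏).ιinf (Γ' i)) ((𝕏).Δ (Γ' i)) (𝕏).κ₁ (𝕏).τ₁)
        (j₂ : ∀ i, {j : (Sit₂ i).E →ₗ[ℂ] ((𝕏).P 2).weilDatum.ThetaTop // ((𝕏).P 2).kernelDatum.IsThetaEquivariant (Sit₂ i).κ (Sit₂ i).σ j})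
        (Sit₃ : ∀ i, KTypeSituation ((𝕏).P 3) ((𝕏).ιinf (Γ' i)) ((𝕏).Δ (Γ' i)) (𝕏).κ₁ (𝕏).τ₁)
        (j₃ : ∀ i, {j : (Sit₃ i).E →ₗ[ℂ] ((𝕏).P 3).weilDatum.ThetaTop // ((𝕏).P 3).kernelDatum.IsThetaEquivariant (Sit₃ i).κ (Sit₃ i).σ j})
        (φ₂ φ₃ : Fin n → Fin 2 → piSchwartzBruhat (𝕏).K (Fin 3)) (a : Fin n → ℂ),
        (∀ i, adm₃₄ hHD hI h₁ h₃ (S V c) hV (Γ' i) 2 (Sit₂ i) ∧ j₂ i ∈ (Sit₂ i).𝓙 ∧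
          adm₃₄ hHD hI h₁ h₃ (S V c) hV (Γ' i) 3 (Sit₃ i) ∧ j₃ i ∈ (Sit₃ i).𝓙) ∧
        (∀ i a', ((𝕏).P 2).weilDatum.toThetaTop (φ₂ i a') = (j₂ i).1 ((Sit₂ i).ι (LinearMap.proj a'))) ∧
        (∀ i a', ((𝕏).P 3).weilDatum.toThetaTop (φ₃ i a') = (j₃ i).1 ((Sit₃ i).ι (LinearMap.proj a'))) ∧
        A.ins f φ = ∑ i, a i • (H.τ (φ₂ i 0) (φ₃ i 1) - H.τ (φ₂ i 1) (φ₃ i 0))) :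
    ∀ (χ : ((pinT hHD hI h₁ h₃ h hA W S μ).t34 V c).X) (Φ : (pinT hHD hI h₁ h₃ h hA W S μ).SK V c),
      ((pinT hHD hI h₁ h₃ h hA W S μ).t34 V c).ϑ χ Φ ∈
        (Submodule.span ℂ (Real34Loc.ofThetaSat hHD hI h₁ h₃ h hA W S μ V c hV hGfin hcorr).wset).topologicalClosure := by
  -- the M-level statement on the span of the inserted vectors, by linearity of `ϑ₃₄(χ, ·)`
  have key : ∀ (χ : ((pinT hHD hI h₁ h₃ h hA W S μ).t34 V c).X)
      (Φ : ↥((wmOf' printFact_unitaryCompact_holds (W V c)).SK)),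
      Φ ∈ Submodule.span ℂ (Set.range fun q : A.FinIdx ×
          (printPlaces (InfinitePlace (L : Type)) kind lam hlam (pinnedVacs kind m₁ m₂)).F =>
            insM printFact_unitaryCompact_holds (W V c) c.D.jT₃₄ kind lam hlam m₁ m₂ A q.1 q.2) →
      ((pinT hHD hI h₁ h₃ h hA W S μ).t34 V c).ϑ χ Φ ∈
        Submodule.span ℂ (Real34Loc.ofThetaSat hHD hI h₁ h₃ h hA W S μ V c hV hGfin hcorr).wset := by
    intro χ Φ hΦ
    induction hΦ using Submodule.span_induction with
    | mem x hx =>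
      obtain ⟨⟨f, φ⟩, rfl⟩ := hx
      obtain ⟨n, Γ', Sit₂, j₂, Sit₃, j₃, φ₂, φ₃, a, hadm, hφ₂, hφ₃, hins⟩ := hwedge f φ
      rw [t34_ϑ_eq_smul_sum_realise_wedge₂ hHD hI h₁ h₃ h hA W S μ V c hV hW H Γ' Sit₂ j₂ Sit₃ j₃ φ₂ φ₃ hφ₂ hφ₃ a χ
        (insM printFact_unitaryCompact_holds (W V c) c.D.jT₃₄ kind lam hlam m₁ m₂ A f φ) hins]
      refine Submodule.smul_mem _ _ (Submodule.sum_mem _ fun i _ => Submodule.smul_mem _ _ (Submodule.subset_span ?_))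
      have hχ := (mem_allowedChars _ _ _).1 χ.2
      exact (Real34Loc.ofThetaSat hHD hI h₁ h₃ h hA W S μ V c hV hGfin hcorr).realise_wedge₂_mem_wset
        (Real34Loc.ofThetaSat_rep_thetaGenElt hHD hI h₁ h₃ h hA W S μ V c hV hGfin hcorr (Γ' i) 2 (Sit₂ i) (hadm i).1
          (j₂ i) (hadm i).2.1 (charFst χ.1)
          ((((S V c).P 2).residualType_iff_hasArchType_neg h2 (charFst χ.1)).2 (by simpa only [d34Of_m₁] using hχ.1)))
        (Real34Loc.ofThetaSat_rep_thetaGenElt hHD hI h₁ h₃ h hA W S μ V c hV hGfin hcorr (Γ' i) 3 (Sit₃ i) (hadm i).2.2.1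
          (j₃ i) (hadm i).2.2.2 (charSnd χ.1)
          ((((S V c).P 3).residualType_iff_hasArchType_neg h3 (charSnd χ.1)).2 (by simpa only [d34Of_m₂] using hχ.2)))
    | zero =>
      rw [t34_ϑ_zero hHD hI h₁ h₃ h hA W S μ V c hW χ]
      exact Submodule.zero_mem _
    | add x y _ _ hx hy =>
      rw [t34_ϑ_add hHD hI h₁ h₃ h hA W S μ V c hW χ x y]
      exact Submodule.add_mem _ hx hy
    | smul a x _ hx =>
      rw [t34_ϑ_smul hHD hI h₁ h₃ h hA W S μ V c hW χ a x]
      exact Submodule.smul_mem _ a hx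
  exact Real34Loc.gen_mem_of_dense hHD hI h₁ h₃ h hA W S μ V c hV _
    (dense_insM printFact_unitaryCompact_holds (W V c) c.D.jT₃₄ kind lam hlam m₁ m₂ A) key

end Generic

/-! ## 3. At the total pins of record: the (34) census side of the context -/

namespace Gen12Pins

variable
  (hGR : ∀ {L : CMField} {ι₁ : L →+* ℂ} (V : HermSpace3 L ι₁) (c : SeesawCtx L),
    (cmSplittingDatum (L : Type) finProdFinEquiv (frameD V) (frameD_real V) (frameD_ne V) (dW c.D) (dW_real c.D)
      (dW_ne c.D)).CompatibleSplitting)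
  (η : ∀ {L : CMField} {ι₁ : L →+* ℂ} (V : HermSpace3 L ι₁) (c : SeesawCtx L),
    CMAdelic (L : Type) (frameD V) × CMAdelic (L : Type) (dW c.D) →* ℂˣ)
  (hη : ∀ {L : CMField} {ι₁ : L →+* ℂ} (V : HermSpace3 L ι₁) (c : SeesawCtx L),
    ∀ γU ∈ CMRat (L : Type) (frameD V), ∀ γ ∈ CMRat (L : Type) (dW c.D), η V c (γU, γ) = 1)
  (hηc : ∀ {L : CMField} {ι₁ : L →+* ℂ} (V : HermSpace3 L ι₁) (c : SeesawCtx L), Continuous fun p => ((η V c p : ℂˣ) : ℂ))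
  (hGR₀ : ∀ {L : CMField} {ι₁ : L →+* ℂ} (V : HermSpace3 L ι₁) (c : SeesawCtx L),
    (cmSplittingDatum (L : Type) (e₁) (frameD V) (frameD_real V) (frameD_ne V) (lineVec (L : Type) (dW c.D 0))
      (fun _ => dW_real c.D 0) (fun _ => dW_ne c.D 0)).CompatibleSplitting)
  (hGR₁ : ∀ {L : CMField} {ι₁ : L →+* ℂ} (V : HermSpace3 L ι₁) (c : SeesawCtx L),
    (cmSplittingDatum (L : Type) (e₁) (frameD V) (frameD_real V) (frameD_ne V) (lineVec (L : Type) (dW c.D 1))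
      (fun _ => dW_real c.D 1) (fun _ => dW_ne c.D 1)).CompatibleSplitting)
  (hGR₂ : ∀ {L : CMField} {ι₁ : L →+* ℂ} (V : HermSpace3 L ι₁) (c : SeesawCtx L),
    (cmSplittingDatum (L : Type) (e₁) (frameD V) (frameD_real V) (frameD_ne V) (lineVec (L : Type) (dW' c.D 0))
      (fun _ => dW'_real c.D 0) (fun _ => dW'_ne c.D 0)).CompatibleSplitting)
  (hGR₃ : ∀ {L : CMField} {ι₁ : L →+* ℂ} (V : HermSpace3 L ι₁) (c : SeesawCtx L),
    (cmSplittingDatum (L : Type) (e₁) (frameD V) (frameD_real V) (frameD_ne V) (lineVec (L : Type) (dW' c.D 1))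
      (fun _ => dW'_real c.D 1) (fun _ => dW'_ne c.D 1)).CompatibleSplitting)
  (A : ∀ {L : CMField} {ι₁ : L →+* ℂ} (V : HermSpace3 L ι₁) (c : SeesawCtx L) (k : Fin 4),
    ArchLineInput V (lineRepD V c.D (hGR V c) (hGR₀ V c) (hGR₁ V c) (hGR₂ V c) (hGR₃ V c) (η V c) k))

variable (hHD : exists_isReal_hodgeModel) (hI : hodgePQ_independent_of_hodgeModel)
  (h₁ : BallQuotientUniformised)  (h₃ : CMAbelianVarietyRealised)
  (h : Bool) (hA : Arapura2012_Cor_15_4_6) (μ : ∀ {L : CMField}, SeesawCtx L → Fin 4 → InfinitePlace L → ℤ)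

section Context34

variable {L : CMField} {ι₁ : L →+* ℂ} (V : HermSpace3 L ι₁) (c : SeesawCtx L) (hV : IsAnisotropic L V.Hm)

local notation3 "L⁺" => maximalRealSubfield (L : Type)

/-- **The (34) CENSUS SIDE of a context, with the wedge decomposition of its generators** — mc-binder-2's `HypCoreW` of the total W pin
for the (34) torus `c.D.jT₃₄` at the (34) exponents `(-μ c 2, -μ c 3)` (THE object behind E's binder `hyp34` at the pins, `HypCensus/SideE.hyp34_of_sideW`),
together with `hwedge`: every inserted printed vector `ins f φ` is a finite sum of wedge tensors `tau34 φ₂⁰ φ₃¹ − tau34 φ₂¹ φ₃⁰` of frame vectors of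
`adm₃₄`-admissible situations of lines `2`, `3` of the total S pin.  A HYPOTHESIS record (one census record + one Prop); nothing asserted. -/
structure Real34CensusSide where
  /-- binder-2's (34) census core of the context at the total W pin -/
  core : HypCoreW ((Wg @hGR @η @hη @hηc @τSyl @TSyl @hTSyl) V c) c.D.jT₃₄ (fun w => -μ c 2 w) (fun w => -μ c 3 w)
  /-- the wedge decomposition of the inserted printed vectors over admissible frames of lines `2`, `3` -/
  hwedge : letI := core.decEq
    ∀ (f : core.side.FinIdx)
      (φ : (printPlaces (InfinitePlace (L : Type)) core.kind core.lam core.hlam (pinnedVacs core.kind (fun w => -μ c 2 w) (fun w => -μ c 3 w))).F),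
      ∃ (n : ℕ) (Γ' : Fin n → Level V)
        (Sit₂ : ∀ i, KTypeSituation ((pinX hHD hI h₁ h₃ (SInstance.S @hGR @η @hη @hηc @hGR₀ @hGR₁ @hGR₂ @hGR₃ @A) V c hV).P 2) ((pinX hHD hI h₁ h₃ (SInstance.S @hGR @η @hη @hηc @hGR₀ @hGR₁ @hGR₂ @hGR₃ @A) V c hV).ιinf (Γ' i))
          ((pinX hHD hI h₁ h₃ (SInstance.S @hGR @η @hη @hηc @hGR₀ @hGR₁ @hGR₂ @hGR₃ @A) V c hV).Δ (Γ' i)) (pinX hHD hI h₁ h₃ (SInstance.S @hGR @η @hη @hηc @hGR₀ @hGR₁ @hGR₂ @hGR₃ @A) V c hV).κ₁ (pinX hHD hI h₁ h₃ (SInstance.S @hGR @η @hη @hηc @hGR₀ @hGR₁ @hGR₂ @hGR₃ @A) V c hV).τ₁)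
        (j₂ : ∀ i, {j : (Sit₂ i).E →ₗ[ℂ] ((pinX hHD hI h₁ h₃ (SInstance.S @hGR @η @hη @hηc @hGR₀ @hGR₁ @hGR₂ @hGR₃ @A) V c hV).P 2).weilDatum.ThetaTop //
          ((pinX hHD hI h₁ h₃ (SInstance.S @hGR @η @hη @hηc @hGR₀ @hGR₁ @hGR₂ @hGR₃ @A) V c hV).P 2).kernelDatum.IsThetaEquivariant (Sit₂ i).κ (Sit₂ i).σ j})
        (Sit₃ : ∀ i, KTypeSituation ((pinX hHD hI h₁ h₃ (SInstance.S @hGR @η @hη @hηc @hGR₀ @hGR₁ @hGR₂ @hGR₃ @A) V c hV).P 3) ((pinX hHD hI h₁ h₃ (SInstance.S @hGR @η @hη @hηc @hGR₀ @hGR₁ @hGR₂ @hGR₃ @A) V c hV).ιinf (Γ' i))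
          ((pinX hHD hI h₁ h₃ (SInstance.S @hGR @η @hη @hηc @hGR₀ @hGR₁ @hGR₂ @hGR₃ @A) V c hV).Δ (Γ' i)) (pinX hHD hI h₁ h₃ (SInstance.S @hGR @η @hη @hηc @hGR₀ @hGR₁ @hGR₂ @hGR₃ @A) V c hV).κ₁ (pinX hHD hI h₁ h₃ (SInstance.S @hGR @η @hη @hηc @hGR₀ @hGR₁ @hGR₂ @hGR₃ @A) V c hV).τ₁)
        (j₃ : ∀ i, {j : (Sit₃ i).E →ₗ[ℂ] ((pinX hHD hI h₁ h₃ (SInstance.S @hGR @η @hη @hηc @hGR₀ @hGR₁ @hGR₂ @hGR₃ @A) V c hV).P 3).weilDatum.ThetaTop //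
          ((pinX hHD hI h₁ h₃ (SInstance.S @hGR @η @hη @hηc @hGR₀ @hGR₁ @hGR₂ @hGR₃ @A) V c hV).P 3).kernelDatum.IsThetaEquivariant (Sit₃ i).κ (Sit₃ i).σ j})
        (φ₂ φ₃ : Fin n → Fin 2 → piSchwartzBruhat (pinX hHD hI h₁ h₃ (SInstance.S @hGR @η @hη @hηc @hGR₀ @hGR₁ @hGR₂ @hGR₃ @A) V c hV).K (Fin 3)) (a : Fin n → ℂ),
        (∀ i, adm₃₄ hHD hI h₁ h₃ ((SInstance.S @hGR @η @hη @hηc @hGR₀ @hGR₁ @hGR₂ @hGR₃ @A) V c) hV (Γ' i) 2 (Sit₂ i) ∧ j₂ i ∈ (Sit₂ i).𝓙 ∧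
          adm₃₄ hHD hI h₁ h₃ ((SInstance.S @hGR @η @hη @hηc @hGR₀ @hGR₁ @hGR₂ @hGR₃ @A) V c) hV (Γ' i) 3 (Sit₃ i) ∧ j₃ i ∈ (Sit₃ i).𝓙) ∧
        (∀ i a', ((pinX hHD hI h₁ h₃ (SInstance.S @hGR @η @hη @hηc @hGR₀ @hGR₁ @hGR₂ @hGR₃ @A) V c hV).P 2).weilDatum.toThetaTop (φ₂ i a') = (j₂ i).1 ((Sit₂ i).ι (LinearMap.proj a'))) ∧
        (∀ i a', ((pinX hHD hI h₁ h₃ (SInstance.S @hGR @η @hη @hηc @hGR₀ @hGR₁ @hGR₂ @hGR₃ @A) V c hV).P 3).weilDatum.toThetaTop (φ₃ i a') = (j₃ i).1 ((Sit₃ i).ι (LinearMap.proj a'))) ∧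
        core.side.ins f φ = ∑ i, a i • (tau34 V c.D (φ₂ i 0) (φ₃ i 1) - tau34 V c.D (φ₂ i 1) (φ₃ i 0))

/-- **(K34) at the total pins from the (34) census side** (§ 2 at `W := Wg …`, `S := SInstance.S …`, `H := SeesawHyp34.ofTotal hdef`,
`h2/h3 := (ST_P_w hdef k).trans (hAw k)`). -/
theorem gen_mem_totalKS (hdef : (∀ j, 0 < (ι₁ (dW c.D j)).re) ∨ ∀ j, (ι₁ (dW c.D j)).re < 0)
    (hcorr : ∀ (Γ : Level V), ∀ δ ∈ levelImage hHD hI h₁ h₃ Γ hV,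
      ∃ x : (V.latticeModel printFact_unitaryCompact_holds).G, x ∈ satLevelRegimeOf V hV Γ.K ∧
        ((SInstance.S @hGR @η @hη @hηc @hGR₀ @hGR₁ @hGR₂ @hGR₃ @A) V c).ιinf δ * x ∈ (V.latticeModel printFact_unitaryCompact_holds).Γ ∧ ∀ y : U21, Commute x (((SInstance.S @hGR @η @hη @hηc @hGR₀ @hGR₁ @hGR₂ @hGR₃ @A) V c).ιinf y))
    (hW : IsAnisotropic L c.D.gramW) (hAw : ∀ k : Fin 4, k = 2 ∨ k = 3 → (A V c k).w = ⇑(archWeight L (μ c k)))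
    (CS : Real34CensusSide @hGR @η @hη @hηc @hGR₀ @hGR₁ @hGR₂ @hGR₃ @A hHD hI h₁ h₃ @μ V c hV) :
    ∀ (χ : ((pinT hHD hI h₁ h₃ h hA (Wg @hGR @η @hη @hηc @τSyl @TSyl @hTSyl) (SInstance.S @hGR @η @hη @hηc @hGR₀ @hGR₁ @hGR₂ @hGR₃ @A) μ).t34 V c).X) (Φ : (pinT hHD hI h₁ h₃ h hA (Wg @hGR @η @hη @hηc @τSyl @TSyl @hTSyl) (SInstance.S @hGR @η @hη @hηc @hGR₀ @hGR₁ @hGR₂ @hGR₃ @A) μ).SK V c),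
      ((pinT hHD hI h₁ h₃ h hA (Wg @hGR @η @hη @hηc @τSyl @TSyl @hTSyl) (SInstance.S @hGR @η @hη @hηc @hGR₀ @hGR₁ @hGR₂ @hGR₃ @A) μ).t34 V c).ϑ χ Φ ∈
        (Submodule.span ℂ (Real34Loc.ofThetaSat hHD hI h₁ h₃ h hA (Wg @hGR @η @hη @hηc @τSyl @TSyl @hTSyl) (SInstance.S @hGR @η @hη @hηc @hGR₀ @hGR₁ @hGR₂ @hGR₃ @A) μ V c hV
          (hGfin_total @hGR @η @hη @hηc @hGR₀ @hGR₁ @hGR₂ @hGR₃ @A V c hV hdef) hcorr).wset).topologicalClosure := by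
  letI := CS.core.decEq
  exact Real34Loc.gen_mem_ofThetaSat_of_sideW hHD hI h₁ h₃ h hA (Wg @hGR @η @hη @hηc @τSyl @TSyl @hTSyl) (SInstance.S @hGR @η @hη @hηc @hGR₀ @hGR₁ @hGR₂ @hGR₃ @A) μ V c hV (hGfin_total @hGR @η @hη @hηc @hGR₀ @hGR₁ @hGR₂ @hGR₃ @A V c hV hdef) hcorr hW
    (SeesawHyp34.ofTotal @hGR @η @hη @hηc @hGR₀ @hGR₁ @hGR₂ @hGR₃ @A V c hdef)
    ((ST_P_w @hGR @η @hη @hηc @hGR₀ @hGR₁ @hGR₂ @hGR₃ @A V c hdef 2).trans (hAw 2 (Or.inl rfl)))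
    ((ST_P_w @hGR @η @hη @hηc @hGR₀ @hGR₁ @hGR₂ @hGR₃ @A V c hdef 3).trans (hAw 3 (Or.inr rfl)))
    CS.core.kind CS.core.lam CS.core.hlam _ _ CS.core.side CS.hwedge

end Context34

/-- **E's binder `real34` AT THE TOTAL PINS from the (34) census sides** (quantified form): as #28 `real34_totalK`, with the K-type datum
REPLACED by one `Real34CensusSide` per good sextic context — i.e. by the object that ALSO discharges E's `hyp34` (+ its `hwedge`). -/
theorem real34_totalKS (hpc : (picardCMUniverse hHD hI h₁ h₃).Fact_pull_comp)
    (hcup : (picardCMUniverse hHD hI h₁ h₃).Fact_pull_cup) (hph : (picardCMUniverse hHD hI h₁ h₃).Fact_pull_hodge)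
    (h31 : (picardCMUniverse hHD hI h₁ h₃).Fact_cmInflation)
    (hLiu : ∀ {L : CMField} {ι₁ : L →+* ℂ} (V : HermSpace3 L ι₁) (c : SeesawCtx L),
      (pinT hHD hI h₁ h₃ h hA (Wg @hGR @η @hη @hηc @τSyl @TSyl @hTSyl) (SInstance.S @hGR @η @hη @hηc @hGR₀ @hGR₁ @hGR₂ @hGR₃ @A) μ).GoodCtx ι₁ c → Module.finrank ℚ c.K = 6 →
      ∀ (i : Fin 4) (Γ : Level V), ∃ (M : CMField) (k : c.K →+* M) (σ' : M →+* ℂ), σ'.comp k = c.σ ∧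
        (pinT hHD hI h₁ h₃ h hA (Wg @hGR @η @hη @hηc @τSyl @TSyl @hTSyl) (SInstance.S @hGR @η @hη @hηc @hGR₀ @hGR₁ @hGR₂ @hGR₃ @A) μ).Theta V c i Γ ⊆ (picardCMUniverse hHD hI h₁ h₃).Uiso Γ M (inflate k (c.Ψ i)) σ')
    (hAw : ∀ {L : CMField} {ι₁ : L →+* ℂ} (V : HermSpace3 L ι₁) (c : SeesawCtx L),
      (pinT hHD hI h₁ h₃ h hA (Wg @hGR @η @hη @hηc @τSyl @TSyl @hTSyl) (SInstance.S @hGR @η @hη @hηc @hGR₀ @hGR₁ @hGR₂ @hGR₃ @A) μ).GoodCtx ι₁ c → ∀ k : Fin 4, k = 2 ∨ k = 3 → (A V c k).w = ⇑(archWeight L (μ c k)))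
    (hcorr : ∀ {L : CMField} {ι₁ : L →+* ℂ} (V : HermSpace3 L ι₁) (c : SeesawCtx L) (hV : IsAnisotropic L V.Hm),
      ∀ (Γ : Level V), ∀ δ ∈ levelImage hHD hI h₁ h₃ Γ hV,
        ∃ x : (V.latticeModel printFact_unitaryCompact_holds).G, x ∈ satLevelRegimeOf V hV Γ.K ∧
          ((SInstance.S @hGR @η @hη @hηc @hGR₀ @hGR₁ @hGR₂ @hGR₃ @A) V c).ιinf δ * x ∈ (V.latticeModel printFact_unitaryCompact_holds).Γ ∧ ∀ y : U21, Commute x (((SInstance.S @hGR @η @hη @hηc @hGR₀ @hGR₁ @hGR₂ @hGR₃ @A) V c).ιinf y))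
    (CS : ∀ {L : CMField} {ι₁ : L →+* ℂ} (V : HermSpace3 L ι₁) (c : SeesawCtx L) (hV : IsAnisotropic L V.Hm),
      (pinT hHD hI h₁ h₃ h hA (Wg @hGR @η @hη @hηc @τSyl @TSyl @hTSyl) (SInstance.S @hGR @η @hη @hηc @hGR₀ @hGR₁ @hGR₂ @hGR₃ @A) μ).GoodCtx ι₁ c → Module.finrank ℚ c.K = 6 → Real34CensusSide @hGR @η @hη @hηc @hGR₀ @hGR₁ @hGR₂ @hGR₃ @A hHD hI h₁ h₃ @μ V c hV)
    {L : CMField} {ι₁ : L →+* ℂ} (V : HermSpace3 L ι₁) (c : SeesawCtx L)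
    (hc : (pinT hHD hI h₁ h₃ h hA (Wg @hGR @η @hη @hηc @τSyl @TSyl @hTSyl) (SInstance.S @hGR @η @hη @hηc @hGR₀ @hGR₁ @hGR₂ @hGR₃ @A) μ).GoodCtx ι₁ c) (hK : Module.finrank ℚ c.K = 6) :
    Nonempty ((pinT hHD hI h₁ h₃ h hA (Wg @hGR @η @hη @hηc @τSyl @TSyl @hTSyl) (SInstance.S @hGR @η @hη @hηc @hGR₀ @hGR₁ @hGR₂ @hGR₃ @A) μ).Real34FunBridge V c) :=
  real34_total @hGR @η @hη @hηc @hGR₀ @hGR₁ @hGR₂ @hGR₃ @A hHD hI h₁ h₃ h hA @μ hpc hcup hph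
    (fun V c hV hc hK =>
      { hcorr := hcorr V c hV
        gen_mem := gen_mem_totalKS @hGR @η @hη @hηc @hGR₀ @hGR₁ @hGR₂ @hGR₃ @A hHD hI h₁ h₃ h hA @μ V c hV
          (planeDefinite_of_goodCtx @hGR @η @hη @hηc @hGR₀ @hGR₁ @hGR₂ @hGR₃ @A hHD hI h₁ h₃ h hA @μ c hc) (hcorr V c hV)
          (hW_total @hGR @η @hη @hηc @hGR₀ @hGR₁ @hGR₂ @hGR₃ @A hHD hI h₁ h₃ h hA @μ c hc) (hAw V c hc) (CS V c hV hc hK)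
        hU₂ := fun Γ => hU_total @hGR @η @hη @hηc @hGR₀ @hGR₁ @hGR₂ @hGR₃ @A hHD hI h₁ h₃ h hA @μ h31 hLiu V c hc hK 2 Γ
        hU₃ := fun Γ => hU_total @hGR @η @hη @hηc @hGR₀ @hGR₁ @hGR₂ @hGR₃ @A hHD hI h₁ h₃ h hA @μ h31 hLiu V c hc hK 3 Γ })
    V c hc hK

/-- **E's binder `real34` IN E's OWN TEXT at the total pins of record, from the (34) census sides.** -/
theorem real34_totalKSE (hpc : (picardCMUniverse hHD hI h₁ h₃).Fact_pull_comp)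
    (hcup : (picardCMUniverse hHD hI h₁ h₃).Fact_pull_cup) (hph : (picardCMUniverse hHD hI h₁ h₃).Fact_pull_hodge)
    (h31 : (picardCMUniverse hHD hI h₁ h₃).Fact_cmInflation)
    (hLiu : ∀ {L : CMField} {ι₁ : L →+* ℂ} (V : HermSpace3 L ι₁) (c : SeesawCtx L),
      (thetaModelOf hHD hI h₁ h₃ h (embOf hHD hI h₁ h₃) (coverOf hHD hI h₁ h₃ hA) (wmOfInput (Wg @hGR @η @hη @hηc @τSyl @TSyl @hTSyl)) (thetaOf _ (thetaClassInputOf _ (fun V c => thetaSpaceInputOf hHD hI h₁ h₃ (SInstance.S @hGR @η @hη @hηc @hGR₀ @hGR₁ @hGR₂ @hGR₃ @A) V c))) (d12Of μ) (d34Of μ)).GoodCtx ι₁ c → Module.finrank ℚ c.K = 6 →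
      ∀ (i : Fin 4) (Γ : Level V), ∃ (M : CMField) (k : c.K →+* M) (σ' : M →+* ℂ), σ'.comp k = c.σ ∧
        (thetaModelOf hHD hI h₁ h₃ h (embOf hHD hI h₁ h₃) (coverOf hHD hI h₁ h₃ hA) (wmOfInput (Wg @hGR @η @hη @hηc @τSyl @TSyl @hTSyl)) (thetaOf _ (thetaClassInputOf _ (fun V c => thetaSpaceInputOf hHD hI h₁ h₃ (SInstance.S @hGR @η @hη @hηc @hGR₀ @hGR₁ @hGR₂ @hGR₃ @A) V c))) (d12Of μ) (d34Of μ)).Theta V c i Γ ⊆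
          (picardCMUniverse hHD hI h₁ h₃).Uiso Γ M (inflate k (c.Ψ i)) σ')
    (hAw : ∀ {L : CMField} {ι₁ : L →+* ℂ} (V : HermSpace3 L ι₁) (c : SeesawCtx L),
      (pinT hHD hI h₁ h₃ h hA (Wg @hGR @η @hη @hηc @τSyl @TSyl @hTSyl) (SInstance.S @hGR @η @hη @hηc @hGR₀ @hGR₁ @hGR₂ @hGR₃ @A) μ).GoodCtx ι₁ c → ∀ k : Fin 4, k = 2 ∨ k = 3 → (A V c k).w = ⇑(archWeight L (μ c k)))
    (hcorr : ∀ {L : CMField} {ι₁ : L →+* ℂ} (V : HermSpace3 L ι₁) (c : SeesawCtx L) (hV : IsAnisotropic L V.Hm),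
      ∀ (Γ : Level V), ∀ δ ∈ levelImage hHD hI h₁ h₃ Γ hV,
        ∃ x : (V.latticeModel printFact_unitaryCompact_holds).G, x ∈ satLevelRegimeOf V hV Γ.K ∧
          ((SInstance.S @hGR @η @hη @hηc @hGR₀ @hGR₁ @hGR₂ @hGR₃ @A) V c).ιinf δ * x ∈ (V.latticeModel printFact_unitaryCompact_holds).Γ ∧ ∀ y : U21, Commute x (((SInstance.S @hGR @η @hη @hηc @hGR₀ @hGR₁ @hGR₂ @hGR₃ @A) V c).ιinf y))
    (CS : ∀ {L : CMField} {ι₁ : L →+* ℂ} (V : HermSpace3 L ι₁) (c : SeesawCtx L) (hV : IsAnisotropic L V.Hm),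
      (pinT hHD hI h₁ h₃ h hA (Wg @hGR @η @hη @hηc @τSyl @TSyl @hTSyl) (SInstance.S @hGR @η @hη @hηc @hGR₀ @hGR₁ @hGR₂ @hGR₃ @A) μ).GoodCtx ι₁ c → Module.finrank ℚ c.K = 6 → Real34CensusSide @hGR @η @hη @hηc @hGR₀ @hGR₁ @hGR₂ @hGR₃ @A hHD hI h₁ h₃ @μ V c hV) :
    ∀ {L : CMField} {ι₁ : L →+* ℂ} (V : HermSpace3 L ι₁) (c : SeesawCtx L),
      (thetaModelOf hHD hI h₁ h₃ h (embOf hHD hI h₁ h₃) (coverOf hHD hI h₁ h₃ hA) (wmOfInput (Wg @hGR @η @hη @hηc @τSyl @TSyl @hTSyl))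
        (thetaOf _ (thetaClassInputOf _ (fun V c => thetaSpaceInputOf hHD hI h₁ h₃ (SInstance.S @hGR @η @hη @hηc @hGR₀ @hGR₁ @hGR₂ @hGR₃ @A) V c))) (d12Of μ) (d34Of μ)).GoodCtx ι₁ c →
      Module.finrank ℚ c.K = 6 →
      Nonempty ((thetaModelOf hHD hI h₁ h₃ h (embOf hHD hI h₁ h₃) (coverOf hHD hI h₁ h₃ hA) (wmOfInput (Wg @hGR @η @hη @hηc @τSyl @TSyl @hTSyl))
        (thetaOf _ (thetaClassInputOf _ (fun V c => thetaSpaceInputOf hHD hI h₁ h₃ (SInstance.S @hGR @η @hη @hηc @hGR₀ @hGR₁ @hGR₂ @hGR₃ @A) V c))) (d12Of μ) (d34Of μ)).Real34FunBridge V c) :=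
  fun V c hc hK => real34_totalKS @hGR @η @hη @hηc @hGR₀ @hGR₁ @hGR₂ @hGR₃ @A hHD hI h₁ h₃ h hA @μ hpc hcup hph h31 hLiu hAw hcorr CS V c hc hK

end Gen12Pins

end HodgeCM.Model

end
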